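import Summits.ABC.ABC.Theses.RibetTakahashiSplit
import Literature.NumberTheory.DiophantineGeometry.MultiplicativeGroupApproximation
import Summits.ABC.ABC.Theorems.RibetTakahashiSplitFewPrimeValuationProductOfParts
import Summits.ABC.ABC.Theorems.RibetTakahashiSplitFewPrimeValuationProductStubNonfaceOfHardCore

/-!
# Line `matveev-face-clearing` for crux `FewPrimeValuationProduct` (stmt-ABC-1563) — lead skeleton, gen 1 (RESHAPED)

Crux (route `RibetTakahashiSplit`, r4): for `E/ℚ` semistable away from `2` with `≤ 3` odd multiplicative
primes, `T(E) := ∏_{p ∥ N} ord_p Δ_min ≤ C_ε N^ε`.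

RESHAPE (lead prover-line-stmt-ABC-1563-1, 2026-08-16). Gen 0 proved, from the LFL input alone
(`∃ K ≥ 1, Dioph.PastenApproximationBound K` = Matveev + Yu over `ℚ` in Pasten's form), the bound on every
POWER-OF-TWO FACE (`stub_faceBound`, landed p84330) and reduced the rest of the Frey class to the open
transcendence statement `TwoLogOnePrime(η)` (sufficient, not necessary). This skeleton replaces that stub by the
statement that is BOTH necessary and sufficient: the crux restricted to hard-core Frey triples, in exponent form,

  `stub_hardCore`:  `x·y·z·k ≤ C_ε (2pqr)^ε` for every solution of `±p^x ± q^y ± 2^k r^z = 0`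
                    (`p, q, r` distinct odd primes, `x, y, z, k ≥ 1`).

* SUFFICIENT: a non-face abc triple on `≤ 4` primes IS such a solution with `∏_{ℓ∣abc} v_ℓ(abc) = xyzk` and
  `rad = 2pqr` (`stub_nonfaceOfHardCore`, provable NOW from the landed shape lemma `decisivePrimeBootstrap_shape`);
  with the face bound this gives the whole Frey part, and `crux_of_frey_of_residual` (landed p89792) the crux.
  NOTE: on non-face triples NO linear form in logarithms is needed any more — the LFL input serves the face only.
* NECESSARY: `FewPrimeValuationProduct → stub_hardCore` (sub-goals `freyFewPrime_of_fewPrimeValuationProduct`,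
  `hardCore_of_freyFewPrime`, provable NOW from the landed Frey translation `ValuationProductOfCurves.exists_curve`:
  `∏ v_ℓ(abc) ≤ 4 T(E_{abc})`, `N ∣ 2^10 rad`).
Hence, modulo the LFL theorem (known; formalisation debt `Dioph.evertseGyory_thm_4_2_1_rat`):
  `FewPrimeValuationProduct ⟺ HardCore ∧ NonFreyResidual`  — both conjuncts verbatim restrictions of the crux,
the first a clean Diophantine statement in the Pillai regime named by the crux docstring, the second the crux on
curves without a numerical Frey shadow (gen 0: promote-stub). The old stub `stub_twoLogOnePrime` remains a
SUFFICIENT route to `stub_hardCore` (landed `stub_decisivePrimeBootstrap`, p86057) and is no longer registered.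

Shape: FOUR registered stubs — `stub_lflInput` (conditional, landed p86610), `stub_hardCore` (OPEN, necessary),
`stub_nonfaceOfHardCore` (LANDED p98652), `stub_nonFreyResidual` (OPEN, necessary) — and the sorry-free composition
`frey_of_face_of_nonface`, `FewPrimeValuationProduct_of` (concludes the route decl BY NAME).
-/

-- `Summit.<Summit>.<Problem>`: for the single-conjunct summit `ABC` the duplicate `ABC.ABC` is mandated.
set_option linter.dupNamespace false

noncomputable section

namespace Summit.ABC.ABC.Cruxes.FewPrimeValuationProduct.MatveevFaceClearing

open scoped BigOperators
open Finset
open Literature.NumberTheory.DiophantineGeometry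
open Summit.ABC.ABC.Theorems.FewPrimeValuationProduct (crux_of_frey_of_residual face_rpow_of_polylog
  stub_faceBound)

/-! ## Registered stubs (signatures fully qualified; no local definitions inside them) -/

/-- **stub 1 — the LFL input (Matveev + Yu over `ℚ`, Pasten's form).** `∃ K ≥ 1, PastenApproximationBound K`.
One line from the unproved named fact `Literature.NumberTheory.DiophantineGeometry.Dioph.evertseGyory_thm_4_2_1_rat`
(`Dioph.pasten2024_thm_2_1`, `one_le_pastenK`); conditional discharge landed (`stub_lflInput_of_evertseGyory`, p86610).
Used ONLY for the power-of-two face. Size: XXL unconditionally / trivial conditionally. -/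
theorem stub_lflInput :
    ∃ K : ℝ, 1 ≤ K ∧ Literature.NumberTheory.DiophantineGeometry.Dioph.PastenApproximationBound K := by
  sorry

/-- **stub 2 — the HARD CORE (OPEN; necessary and sufficient for the non-face Frey part).** For every
`ε > 0` there is `C` such that every solution of `p^x + q^y = 2^k r^z`, `p^x + 2^k r^z = q^y` or
`q^y + 2^k r^z = p^x` in distinct odd primes `p, q, r` and exponents `x, y, z, k ≥ 1` has
`x·y·z·k ≤ C · (2pqr)^ε`. This is the crux VERBATIM on the Frey curves of hard-core triples
(`T(E) ≍ xyz·max(1, 2k−8)`, `N = 2^t pqr`); it implies the Disproof's `∀ ε > 0, ∃ C, HardCoreBoundWith C ε`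
(`xyz` only) and follows from it given the LFL input (`k ≤ polylog` by the 2-adic clause). Known: `k ≪ log p log q
log log c` (2-adic, free); the bound holds when `min(p,q,r) ≤ rad^{ε/5}` (`stub_smallPrimeClearing`, p84752) and in
the unbalanced regime (archimedean clause); OPEN exactly for balanced triples with all three odd primes large —
abc/Pillai strength, `Literature.Barriers.ABC.BakerMethodBounds` (factor `p` of the `p`-adic clause). -/
theorem stub_hardCore :
    ∀ ε : ℝ, 0 < ε → ∃ C : ℝ, ∀ p q r x y z k : ℕ, p.Prime → q.Prime → r.Prime →
      Odd p → Odd q → Odd r → p ≠ q → p ≠ r → q ≠ r → 0 < x → 0 < y → 0 < z → 0 < k →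
      (p ^ x + q ^ y = 2 ^ k * r ^ z ∨ p ^ x + 2 ^ k * r ^ z = q ^ y ∨ q ^ y + 2 ^ k * r ^ z = p ^ x) →
      ((x * y * z * k : ℕ) : ℝ) ≤ C * ((2 * p * q * r : ℕ) : ℝ) ^ ε := by
  sorry

/-- **stub 3 — non-face triples from the hard core (LANDED p98652; pure shape combinatorics).** A non-face abc
triple on `≤ 4` primes has the shape `{a, b, c} = {ℓ^x, P^y, 2^k Q^z}`-up-to-which-member-is-even
(`decisivePrimeBootstrap_shape`, `decisivePrimeBootstrap_member_eq`, landed p85406), with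
`∏_{p ∣ abc} v_p(abc) = x·y·z·k` (`decisivePrimeBootstrap_prod_factorization_eq`) and `rad(abc) = 2ℓPQ`; so the
hard-core bound is exactly the valuation-product bound on non-face triples. Size S–M. -/
theorem stub_nonfaceOfHardCore :
    (∀ ε : ℝ, 0 < ε → ∃ C : ℝ, ∀ p q r x y z k : ℕ, p.Prime → q.Prime → r.Prime →
      Odd p → Odd q → Odd r → p ≠ q → p ≠ r → q ≠ r → 0 < x → 0 < y → 0 < z → 0 < k →
      (p ^ x + q ^ y = 2 ^ k * r ^ z ∨ p ^ x + 2 ^ k * r ^ z = q ^ y ∨ q ^ y + 2 ^ k * r ^ z = p ^ x) →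
      ((x * y * z * k : ℕ) : ℝ) ≤ C * ((2 * p * q * r : ℕ) : ℝ) ^ ε) →
    ∀ ε : ℝ, 0 < ε → ∃ C : ℝ, ∀ a b c : ℕ, Literature.NumberTheory.DiophantineGeometry.IsABCTriple a b c →
      (a * b * c).primeFactors.card ≤ 4 →
      ¬ ((∃ j : ℕ, a = 2 ^ j) ∨ (∃ j : ℕ, b = 2 ^ j) ∨ (∃ j : ℕ, c = 2 ^ j)) →
      ((∏ p ∈ (a * b * c).primeFactors, (a * b * c).factorization p : ℕ) : ℝ) ≤
        C * (Literature.NumberTheory.DiophantineGeometry.rad a b c : ℝ) ^ ε :=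
  -- LANDED (wave 1, p98652): Theorems/RibetTakahashiSplitFewPrimeValuationProductStubNonfaceOfHardCore.lean
  Summit.ABC.ABC.Theorems.FewPrimeValuationProduct.stub_nonfaceOfHardCore

/-- **stub 4 — the non-Frey residual (OPEN; crux-implied; gen 0: promote-stub).** The crux VERBATIM on the
curves of the class that admit no numerical Frey shadow (no abc triple whose odd primes are all multiplicative for
`W` and whose exponents dominate the component orders). Non-empty: every curve of conductor `2^s·p` with `p` not of
Fermat/Mersenne type (11a, 52a, 176a, …). Szpiro ⟹ it (Disproof §3); in print only `T ≤ C N^{11/2+ε}` (Pasten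
Cor. 16.2) / `N = p` (Mestre–Oesterlé). Mechanisms on record: `Ideas/hasse-pinning-fixed-level.md`,
`Ideas/switching-triangle.md` (levers: pairwise RT at two-prime level = Conj. 1.14-strength; fixed-level depth =
Frey–Mazur/GRH-strength). Size XL / OPEN. -/
theorem stub_nonFreyResidual :
    ∀ ε : ℝ, 0 < ε → ∃ C : ℝ, ∀ (W : WeierstrassCurve ℚ) [W.IsElliptic],
      (∀ p : ℕ, p.Prime → p ≠ 2 → ¬ p ^ 2 ∣ W.conductorNorm ℤ) →
      ((W.conductorNorm ℤ).primeFactors.filter (fun p => p ≠ 2 ∧ ¬ p ^ 2 ∣ W.conductorNorm ℤ)).card ≤ 3 →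
      (¬ ∃ a b c : ℕ, Literature.NumberTheory.DiophantineGeometry.IsABCTriple a b c ∧
          (∀ p : ℕ, p.Prime → p ≠ 2 → p ∣ a * b * c → p ∣ W.conductorNorm ℤ) ∧
          (∀ p ∈ (W.conductorNorm ℤ).primeFactors, ¬ p ^ 2 ∣ W.conductorNorm ℤ →
            (W.minimalDiscriminantNorm ℤ).factorization p ≤ 2 * (a * b * c).factorization p)) →
      ((∏ p ∈ (W.conductorNorm ℤ).primeFactors with ¬ p ^ 2 ∣ W.conductorNorm ℤ,
          (W.minimalDiscriminantNorm ℤ).factorization p : ℕ) : ℝ) ≤ C * (W.conductorNorm ℤ : ℝ) ^ ε := by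
  sorry

/-! ## Composition (sorry-free) -/

/-- **The Frey part from the face and the non-face bounds**: `∏_{p ∣ abc} v_p(abc) ≤ K_ε rad^ε` on every abc
triple supported on `≤ 4` primes, by excluded middle on "some member is a power of two". [folklore] -/
theorem frey_of_face_of_nonface
    (hface : ∀ ε : ℝ, 0 < ε → ∃ C : ℝ, ∀ a b c : ℕ, IsABCTriple a b c → (a * b * c).primeFactors.card ≤ 4 →
      ((∃ j : ℕ, a = 2 ^ j) ∨ (∃ j : ℕ, b = 2 ^ j) ∨ (∃ j : ℕ, c = 2 ^ j)) →
      ((∏ p ∈ (a * b * c).primeFactors, (a * b * c).factorization p : ℕ) : ℝ) ≤ C * (rad a b c : ℝ) ^ ε)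
    (hnon : ∀ ε : ℝ, 0 < ε → ∃ C : ℝ, ∀ a b c : ℕ, IsABCTriple a b c → (a * b * c).primeFactors.card ≤ 4 →
      ¬ ((∃ j : ℕ, a = 2 ^ j) ∨ (∃ j : ℕ, b = 2 ^ j) ∨ (∃ j : ℕ, c = 2 ^ j)) →
      ((∏ p ∈ (a * b * c).primeFactors, (a * b * c).factorization p : ℕ) : ℝ) ≤ C * (rad a b c : ℝ) ^ ε) :
    ∀ ε : ℝ, 0 < ε → ∃ K : ℝ, ∀ a b c : ℕ, IsABCTriple a b c → (a * b * c).primeFactors.card ≤ 4 →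
      ((∏ p ∈ (a * b * c).primeFactors, (a * b * c).factorization p : ℕ) : ℝ) ≤ K * (rad a b c : ℝ) ^ ε := by
  intro ε hε
  obtain ⟨C₁, hC₁⟩ := hface ε hε
  obtain ⟨C₂, hC₂⟩ := hnon ε hε
  refine ⟨max C₁ C₂, fun a b c habc hcard => ?_⟩
  have hrad0 : (0 : ℝ) ≤ (rad a b c : ℝ) := Nat.cast_nonneg _
  have hrε : 0 ≤ (rad a b c : ℝ) ^ ε := Real.rpow_nonneg hrad0 ε
  by_cases hf : (∃ j : ℕ, a = 2 ^ j) ∨ (∃ j : ℕ, b = 2 ^ j) ∨ (∃ j : ℕ, c = 2 ^ j)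
  · exact (hC₁ a b c habc hcard hf).trans (mul_le_mul_of_nonneg_right (le_max_left _ _) hrε)
  · exact (hC₂ a b c habc hcard hf).trans (mul_le_mul_of_nonneg_right (le_max_right _ _) hrε)

/-- **Skeleton theorem**: the crux `Summit.ABC.ABC.Theses.RibetTakahashiSplit.FewPrimeValuationProduct` BY NAME
from the four registered stubs: stub 1 ⟹ face bound (`stub_faceBound`, `face_rpow_of_polylog`, landed); stubs 2–3
⟹ non-face bound; `frey_of_face_of_nonface`; stub 4 is the residual; `crux_of_frey_of_residual` (landed).
[folklore] -/
theorem FewPrimeValuationProduct_of :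
    Summit.ABC.ABC.Theses.RibetTakahashiSplit.FewPrimeValuationProduct :=
  crux_of_frey_of_residual
    (frey_of_face_of_nonface
      (face_rpow_of_polylog (stub_faceBound stub_lflInput))
      (stub_nonfaceOfHardCore stub_hardCore))
    stub_nonFreyResidual

end Summit.ABC.ABC.Cruxes.FewPrimeValuationProduct.MatveevFaceClearing

end
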